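import Summits.BirchSwinnertonDyer.BirchSwinnertonDyer.Theorems.PrintCf2SplitBadTwoDyadicTorsionTable
import Literature.NumberTheory.EllipticCurves.LeadingTermBSZOrdinaryProofs
import Literature.NumberTheory.EllipticCurves.TamagawaVariableChangeProofs
import HarnessLib

set_option linter.dupNamespace false -- `…BirchSwinnertonDyer.BirchSwinnertonDyer…` is the cell's namespace (D-0017)
set_option autoImplicit false

/-!
# The DYADIC TORSION TABLE of the split-bad class, IV: read on an ARBITRARY (globally minimal) model `W` of
# `49a1^{(d)}` — the binder shape `C • W = cm7.quadraticTwist d` of the stubs S2′ / S3b of road α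

Cell `bsd-print-cf2`, width seat `bsd-line-cf2-p1-w4` g6 (`--supports stmt-BirchSwinnertonDyer-20368`, crux
`PrintCf2.SplitBadTwoRankOneOfFacts`, road α, skeleton of record v8). Theses-free; theorems only; no `sorry`. HONEST
FRAMING: transport of the siblings' 2-adic bookkeeping along `ℚ`-isomorphisms; nothing about `L`-values; BSD is not
proved by any of this and no summit statement is proved by this seat.

The registered research stubs `stub_rubinValueFormula_two` (S2′) and `stub_ellipticUnitDescent_two` (S3b) quantify over
`d ≠ 0`, `Squarefree d`, `d % 4 ≠ 1`, and a GLOBALLY MINIMAL `W` with `C • W = cm7.quadraticTwist d`; their local datum at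
`2` is `ℓ = ord₂ (log_Ŵ([c₀]P)/c₀) = ord₂ log_ω(P)`. This file states the dyadic table in exactly that shape:
* `addv_two_of_smul_eq_quadraticTwist` — `W` is ADDITIVE at `2` (bsd-goldfeld's `additive_two_seven_cellTwist` moved along
  the `ℚ`-isomorphism by the tree's `hasGood/MultiplicativeReductionAtPrime_smul_iff`);
* `localTamagawaNumber_two_of_smul_eq_quadraticTwist` — `c₂(W) = 4` (bsd-goldfeld, transported by
  `localTamagawaNumber_variableChange_holds`);
* `padicValNat_card_torsion_two_of_smul_eq_quadraticTwist` — **`t = v₂ #W(ℚ₂)_tors = 3` if `d ≡ 3 (mod 8)`, else `2`**;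
* `range_padicLog_two_of_smul_eq_quadraticTwist` — **`log_ω(W(ℚ₂)) = 2^{t−2}ℤ₂`: `2ℤ₂` if `d ≡ 3 (mod 8)`, else `ℤ₂`**
  (b2b-bsdres' `range_padicLog_baseChange_of_addv`). Consequence for the stubs: with `i_P = [W(ℚ₂)/tors : ℤ₂·P]` the local
  index of the Mordell–Weil generator, `ℓ = ord₂ i_P + (t − 2)`, i.e. any EXPLICIT table `e_A / e_B([d]₂)` differs by `2` on
  `m` between the key `(1,3)` and the other five keys in the index currency.

References: [SilvermanAEC2009] IV.6.4, VII.1 Prop. 1.3(b), VII.5 Prop. 5.1, VII.6.3; [Serre1973] Ch. II §3.3 Thm 4;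
[Kim2022StructureSelmer] §3.2.3, Lemma 3.10.
-/

noncomputable section

open scoped Classical

open WeierstrassCurve Literature.NumberTheory.QuadraticForms Literature.NumberTheory.EllipticCurves
open Literature.NumberTheory.EllipticCurves.Rank1Residual
open Summit.BirchSwinnertonDyer.Rank1Residual.Additive.LocalLog

namespace Summit.BirchSwinnertonDyer.BirchSwinnertonDyer.Theorems.PrintCf2.DyadicTorsion

variable {d : ℤ}

/-- Every model of `49a1^{(d)}` is `ℚ`-isomorphic to bsd-goldfeld's `X_d = cm7.quadraticTwist (4d)`. [cite: SilvermanAEC2009, X.5 Cor. 5.4] -/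
theorem exists_smul_eq_cellTwist (W : WeierstrassCurve ℚ) {C : VariableChange ℚ} (hC : C • W = cm7.quadraticTwist (d : ℚ)) :
    ∃ C' : VariableChange ℚ, C' • W = cm7.quadraticTwist (((4 * d : ℤ)) : ℚ) := by
  obtain ⟨C', hC'⟩ := GoldfeldGoodTwists.exists_smul_eq_cellModel_baseChange W hC
  exact ⟨C', by rw [hC', GoldfeldGoodTwists.cellModel_baseChange]⟩

/-- **Every model `W` of `49a1^{(d)}` (`d` squarefree, `d ≢ 1 (mod 4)`) is ADDITIVE at `2`** (`Addv W 2`), transported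
from bsd-goldfeld's `additive_two_seven_cellTwist` along the `ℚ`-isomorphism. [cite: SilvermanAEC2009, VII.5 Prop. 5.1 and VII.1 Prop. 1.3(b)] -/
theorem addv_two_of_smul_eq_quadraticTwist (hsq : Squarefree d) (hd4 : d % 4 ≠ 1) (W : WeierstrassCurve ℚ) [W.IsElliptic]
    {C : VariableChange ℚ} (hC : C • W = cm7.quadraticTwist (d : ℚ)) : Addv W 2 := by
  obtain ⟨C', hC'⟩ := exists_smul_eq_cellTwist W hC
  haveI : Fact (Nat.Prime 7) := ⟨by norm_num⟩
  have h := (GoldfeldGoodTwists.additive_two_seven_cellTwist hsq hd4).1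
  rw [← hC'] at h
  exact ⟨fun hg => h.1 ((BSZLemma17.hasGoodReductionAtPrime_smul_iff W C' 2).mpr hg),
    fun hm => h.2 ((BSZLemma17.hasMultiplicativeReductionAtPrime_smul_iff W C' 2).mpr hm)⟩

/-- **`c₂(W) = 4` for every model `W` of `49a1^{(d)}`** (`d` squarefree, `d ≢ 1 (mod 4)`), Mathlib's `2`-adics.
[cite: Silverman1994, IV.9.4 Step 7 and Table 4.1] [cite: SilvermanAEC2009, VII.1 Prop. 1.3(b)] -/
theorem localTamagawaNumber_two_of_smul_eq_quadraticTwist (hsq : Squarefree d) (hd4 : d % 4 ≠ 1)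
    (W : WeierstrassCurve ℚ) [W.IsElliptic] {C : VariableChange ℚ} (hC : C • W = cm7.quadraticTwist (d : ℚ)) :
    (W.baseChange ℚ_[2]).localTamagawaNumber ℤ_[2] = 4 := by
  obtain ⟨C', hC'⟩ := exists_smul_eq_cellTwist W hC
  have h := GoldfeldGoodTwists.localTamagawaNumber_padic_cellTwist_two hsq hd4
  rw [← hC', VariableChange.baseChange_smul_eq,
    WeierstrassCurve.localTamagawaNumber_variableChange_holds ℤ_[2] (W.baseChange ℚ_[2])] at h
  exact h

/-- **`t = v₂ #W(ℚ₂)_tors` for every globally minimal model `W` of `49a1^{(d)}`**: `3` if `d ≡ 3 (mod 8)`, else `2`.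
[cite: Kim2022StructureSelmer, Lemma 3.10] [cite: Serre1973, Ch. II §3.3 Thm 4] -/
theorem padicValNat_card_torsion_two_of_smul_eq_quadraticTwist (hsq : Squarefree d) (hd4 : d % 4 ≠ 1)
    (W : WeierstrassCurve ℚ) [W.IsElliptic] [W.IsGloballyMinimal] {C : VariableChange ℚ}
    (hC : C • W = cm7.quadraticTwist (d : ℚ)) :
    padicValNat 2 (Nat.card (AddCommGroup.torsion (W.baseChange ℚ_[2]).toAffine.Point)) = if d % 8 = 3 then 3 else 2 := by
  have h := natCard_primaryComponent_point_eq_pow (p := 2) (W.baseChange ℚ_[2])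
  rw [natCard_primaryComponent_two_of_smul_eq_quadraticTwist hsq hd4 W hC] at h
  split_ifs at h ⊢ with h8
  · exact (Nat.pow_right_injective le_rfl (h.symm.trans (by norm_num : (8 : ℕ) = 2 ^ 3))).symm ▸ rfl
  · exact (Nat.pow_right_injective le_rfl (h.symm.trans (by norm_num : (4 : ℕ) = 2 ^ 2))).symm ▸ rfl

/-- **THE 2-ADIC LOG IMAGE for every globally minimal model `W` of `49a1^{(d)}`** (`d` squarefree, `d ≢ 1 (mod 4)`):
`log_ω(W(ℚ₂)) = 2ℤ₂` if `d ≡ 3 (mod 8)`, `= ℤ₂` otherwise — in the binder shape of S2′/S3b.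
[cite: Kim2022StructureSelmer, §3.2.3 (display before Thm. 3.7) and Lemma 3.10] [cite: SilvermanAEC2009, IV.6.4, VII.6.3] -/
theorem range_padicLog_two_of_smul_eq_quadraticTwist (hsq : Squarefree d) (hd4 : d % 4 ≠ 1)
    (W : WeierstrassCurve ℚ) [W.IsElliptic] [W.IsGloballyMinimal] {C : VariableChange ℚ}
    (hC : C • W = cm7.quadraticTwist (d : ℚ)) :
    (padicLog (W.baseChange ℚ_[2])).range =
      (Submodule.span ℤ_[2] {(2 : ℚ_[2]) ^ (if d % 8 = 3 then (1 : ℤ) else 0)}).toAddSubgroup := by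
  rw [range_padicLog_baseChange_of_addv W 2 (addv_two_of_smul_eq_quadraticTwist hsq hd4 W hC),
    padicValNat_card_torsion_two_of_smul_eq_quadraticTwist hsq hd4 W hC,
    localTamagawaNumber_two_of_smul_eq_quadraticTwist hsq hd4 W hC,
    show padicValNat 2 4 = 2 by rw [show (4 : ℕ) = 2 ^ 2 by norm_num, padicValNat.prime_pow]]
  split_ifs <;> norm_num

/-- **The displayed form for road α** (S2′/S3b binders verbatim: `d ≠ 0`, `Squarefree d`, `d % 4 ≠ 1`, `W` globally minimal,
`C • W = cm7.quadraticTwist d`): the 2-adic torsion exponent and the log image of `W(ℚ₂)` depend on `d` only through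
`d % 8 = 3`, with `#W(ℚ₂)[2^∞] ∈ {8, 4}`, `c₂(W) = 4`, `log_ω(W(ℚ₂)) = 2^{t−2} ℤ₂`. [cite: Serre1973, Ch. II §3.3 Thm 4]
[cite: Kim2022StructureSelmer, Lemma 3.10] -/
theorem dyadicTable_of_smul_eq_quadraticTwist :
    ∀ (d : ℤ), d ≠ 0 → Squarefree d → d % 4 ≠ 1 →
    ∀ (W : WeierstrassCurve ℚ) [W.IsElliptic] [W.IsGloballyMinimal] (C : VariableChange ℚ),
      C • W = cm7.quadraticTwist (d : ℚ) →
      Nat.card (AddCommGroup.primaryComponent (W.baseChange ℚ_[2]).toAffine.Point 2) = (if d % 8 = 3 then 8 else 4) ∧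
      (W.baseChange ℚ_[2]).localTamagawaNumber ℤ_[2] = 4 ∧
      padicValNat 2 (Nat.card (AddCommGroup.torsion (W.baseChange ℚ_[2]).toAffine.Point)) = (if d % 8 = 3 then 3 else 2) ∧
      (padicLog (W.baseChange ℚ_[2])).range =
        (Submodule.span ℤ_[2] {(2 : ℚ_[2]) ^ (if d % 8 = 3 then (1 : ℤ) else 0)}).toAddSubgroup := by
  intro d _ hsq hd4 W _ _ C hC
  exact ⟨natCard_primaryComponent_two_of_smul_eq_quadraticTwist hsq hd4 W hC,
    localTamagawaNumber_two_of_smul_eq_quadraticTwist hsq hd4 W hC,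
    padicValNat_card_torsion_two_of_smul_eq_quadraticTwist hsq hd4 W hC,
    range_padicLog_two_of_smul_eq_quadraticTwist hsq hd4 W hC⟩

end Summit.BirchSwinnertonDyer.BirchSwinnertonDyer.Theorems.PrintCf2.DyadicTorsion
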